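import Summits.BirchSwinnertonDyer.BirchSwinnertonDyer.Theorems.EisensteinPrimesBSDpOnCellCTelescopeCarrierAlgWOfDivInt
import Summits.BirchSwinnertonDyer.BirchSwinnertonDyer.Theorems.EisensteinPrimesBSDpOnCellCTelescopeHerbrandTranslate
import Literature.NumberTheory.EllipticCurves.BigGaloisRepSelmer
import Literature.NumberTheory.IwasawaTheory.IwasawaAlgebraTwoVarRegularProofs
import Summits.BirchSwinnertonDyer.BirchSwinnertonDyer.Theorems.EisensteinPrimesBSDpOnCellCTelescopeK2DivIntOfModuleDiv
import HarnessLib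

/-!
# [telescope v16 — successor LEAD cruxlead-19034 g4, 2026-08-30] PREFIX⁺ RE-PORT: the road-prefix package of the leaves gains two trailing conjuncts,
# (wt) `∃ M, ∀ k, (p : ℤ_[p])^M * x k = ((D k).k − 2 : ℤ)` (the chart variable IS the rescaled weight — `IsPNewBranchAnalyticChart` clause (wt)) and
# (rat) `∀ k, Function.Surjective (algebraMap ℤ_[p] (padicCoeffIntegers (D k).ι))` (the members on the étale branch through the RATIONAL newform f_E are
# ℚ_p-rational — print: Hida 1986 Cor. 1.4, Greenberg–Stevens 1993 §2, Venerucci 2016 §2.4; typer flag T1-R0), so that the construction leaf N1 no longer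
# CLAIMS (rat_k) about its input (width x2-p2 g23 `N1-TYPING-x2p2g23.md`, ideator g40 `N1-PRICING.md` §0; LEAD ruling STATUS 08:45:48Z). Statement = the
# F-form original with the two conjuncts appended at EVERY occurrence of the package; proof token-identical.
# THIS FILE = `TelescopeK2DivIntOfModuleDivF` (member clauses in F-form) on prefix⁺, hypothesis and conclusion. (`--supports`, helper; closes nothing; THEOREMS ONLY; BSD proved for no curve.)
-/

set_option autoImplicit false
set_option linter.dupNamespace false

noncomputable section

open scoped Classical MatrixGroups ModularForm

open CongruenceSubgroup WeierstrassCurve NumberField IsDedekindDomain Field PowerSeries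
  Literature.NumberTheory.EllipticCurves Literature.NumberTheory.EllipticCurves.GreenbergSelmer
  Literature.NumberTheory.EllipticCurves.ModularForms Literature.NumberTheory.QuadraticFields
  Literature.NumberTheory.EllipticCurves.Rank1Residual
  Literature.NumberTheory.EllipticCurves.Rank1Residual.Typed
  Literature.NumberTheory.GaloisRepresentations Literature.NumberTheory.GaloisCohomology
  Summit.BirchSwinnertonDyer.Rank1Residual.X11b.AcSelmer
  Summit.BirchSwinnertonDyer.Rank1Residual.X11b.Halves
  Summit.BirchSwinnertonDyer.Rank1Residual.X11b
  Summit.BirchSwinnertonDyer.Rank1Residual Summit.BirchSwinnertonDyer.Rank1Residual.X1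
  Summit.BirchSwinnertonDyer.Rank1Residual.X2

open Literature.NumberTheory.EllipticCurves.BigGaloisRep
open Literature.NumberTheory.EllipticCurves.Castella2018

namespace Summit.BirchSwinnertonDyer.BirchSwinnertonDyer.Theorems.TelescopeK2DivIntOfModuleDivFP

open Summit.BirchSwinnertonDyer.BirchSwinnertonDyer.Theorems

/-! ## §K The kernel: K2-M♭ ⟹ K2-D♭ (sorry-free, no side hypotheses) -/

set_option maxHeartbeats 1600000 in
/-- **K2-D♭ from K2-M♭** (`stub_carrierDivInt` of telescope v6 from `K2Mod.stub_branchFibreDiv`, texts verbatim): `F₀ :=` a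
generator of `char_B(X₂)` non-vanishing at `X ↦ 0`; (nondeg), (alg∞) from (div₀); per member `Φ₀ := F₀(x_k,T) ≠ 0`,
`Φ₀ ≡ F₀ (mod X − x_k)`, and the one-sided Herbrand inclusion (p739501) under (ctrl_k). [folklore] -/
theorem carrierDivInt_of_branchFibreDiv
    (hM :
    ∀ (W : WeierstrassCurve ℚ) [W.IsElliptic] [W.IsGloballyMinimal] (p : ℕ) [Fact p.Prime],
    ∀ (N : ℕ) [NeZero N] (K : Type) [Field K] [NumberField K] (Dt : ModularParametrizationData W N)
      (H : HeegnerDatum N (NumberField.discr K)) (ιK : K →+* ℂ) (P : (W.baseChange K).toAffine.Point),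
      CellC W p → W.conductorNorm ℤ = N →
      IsImaginaryQuadratic K → NumberField.discr K < -4 → SatisfiesHeegnerHypothesis N K →
      (W.quadraticTwist (NumberField.discr K : ℚ)).entireLFunction 1 ≠ 0 →
      WeierstrassCurve.Affine.Point.map ιK.toRatAlgHom P = heegnerPointComplex Dt H →
      ¬ (p : ℤ) ∣ Dt.c → ¬ IsOfFinAddOrder P →
      Odd (NumberField.discr K) →
      ∀ (κ : ZpExtension K p), κ.IsAnticyclotomic →
        ∀ (γ : Field.absoluteGaloisGroup K) [Fact (κ.IsTopGenerator γ)]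
          (𝔭 : HeightOneSpectrum (𝓞 K)), ((p : ℕ) : 𝓞 K) ∈ 𝔭.asIdeal →
          𝔭.asIdeal.ramificationIdx (𝓞 ℚ) = 1 → 𝔭.asIdeal.inertiaDeg (𝓞 ℚ) = 1 →
          ∀ (𝔭bar : HeightOneSpectrum (𝓞 K)), ((p : ℕ) : 𝓞 K) ∈ 𝔭bar.asIdeal → 𝔭bar ≠ 𝔭 →
            ((Ideal.span {(p : ℤ)}).primesOver (𝓞 K)).ncard = 2 →
          ∀ (f : CuspForm (CongruenceSubgroup.Gamma0 N) 2), IsNewformOf W f →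
            ∀ (ι' : PadicAlgCl p ≃+* ℂ),
              (∀ (w : InfinitePlace K) (k : 𝓞 K),
                k ∈ 𝔭.asIdeal ↔ ‖ι'.symm (w.embedding (k : K))‖ < 1) →
              ∀ (ΩK : ℂ) (Ωp : ℂ_[p]) (Q : PowerSeries 𝓞_ℂ_[p]), ΩK ≠ 0 → ‖Ωp‖ = 1 →
                R1.IsBDPLFunctionInt p ι' 𝔭 κ γ f ΩK Ωp Q →
      ∀ (L : PowerSeries (PowerSeries (unrIntegers p))) (x : ℕ → ℤ_[p]) (D : ℕ → Skinner2016.HidaCongruentForm W p 1),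
        (∀ k, ‖x k‖ < 1) ∧ Filter.Tendsto x Filter.atTop (nhds 0) ∧
        (∃ e : ℕ, PowerSeries.C ((p : 𝓞_ℂ_[p]) ^ e) * Q ∈
          Ideal.span {PowerSeries.map (R1.unrToCpInt p) (PowerSeries.map (PowerSeries.constantCoeff (R := unrIntegers p)) L)}) ∧
        (∀ k : ℕ, (∀ y : coeffField (D k).g, ι' ((D k).ι y) = (y : ℂ)) ∧ 2 * ((p : ℤ) - 1) ∣ (D k).k - 2 ∧
          ∃ (ΩKg : ℂ) (Ωpg : ℂ_[p]) (Lg : UnrSeries p), ΩKg ≠ 0 ∧ ‖Ωpg‖ = 1 ∧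
            IsBDPLFunctionWt ι' 𝔭 κ γ (D k).g ΩKg Ωpg Lg ∧
          ∃ Ψ : UnrSeries p,
            (∃ U : PowerSeries (PowerSeries (unrIntegers p)),
              PowerSeries.map (PowerSeries.C (R := unrIntegers p)) Ψ =
                L + PowerSeries.C (PowerSeries.X - PowerSeries.C (toUnr p (x k))) * U) ∧
            (∃ e : ℕ, PowerSeries.C ((p : 𝓞_ℂ_[p]) ^ e) * PowerSeries.map (R1.unrToCpInt p) Ψ ∈
              Ideal.span {PowerSeries.map (R1.unrToCpInt p) Lg})) ∧
        (∃ A : ℕ → UnrSeries p, ∀ ℓ : ℕ, ℓ.Prime → ¬ ℓ ∣ N →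
          (∃ U : UnrSeries p, A ℓ = PowerSeries.C (toUnr p ((W.frobeniusTrace ℓ : ℤ) : ℤ_[p])) + PowerSeries.X * U) ∧
          ∀ k : ℕ, ∃ (c : unrIntegers p) (U : UnrSeries p),
            A ℓ = PowerSeries.C c + (PowerSeries.X - PowerSeries.C (toUnr p (x k))) * U ∧
            ((c : ℂ_[p]) = algebraMap (PadicAlgCl p) ℂ_[p]
              ((D k).ι ⟨(UpperHalfPlane.qExpansion 1 ⇑(D k).g).coeff ℓ, coeff_mem_coeffField (D k).g ℓ⟩))) ∧
        (∃ M : ℕ, ∀ k : ℕ, ((p : ℤ_[p]) ^ M) * x k = (((D k).k - 2 : ℤ) : ℤ_[p])) ∧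
        (∀ k : ℕ, Function.Surjective (algebraMap ℤ_[p] (padicCoeffIntegers (D k).ι))) →
      ∃ (_ : TopologicalSpace (PowerSeries ℤ_[p])) (A₂ : Type) (_ : AddCommGroup A₂)
        (_ : Module (PowerSeries ℤ_[p]) A₂) (_ : TopologicalSpace A₂) (_ : DiscreteTopology A₂)
        (ρ₂ : ContinuousRep (Field.absoluteGaloisGroup K) (PowerSeries ℤ_[p]) A₂)
        (_ : TopologicalSpace (PowerSeries (PowerSeries ℤ_[p])))
        (_ : ContinuousSMul (PowerSeries (PowerSeries ℤ_[p])) (BigRepModule (PowerSeries ℤ_[p]) p A₂))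
        (_ : Module (PowerSeries ℤ_[p]) (XBig κ ρ₂ 𝔭bar (∅ : Set (HeightOneSpectrum (𝓞 K)))))
        (_ : IsScalarTower (PowerSeries ℤ_[p]) (PowerSeries (PowerSeries ℤ_[p]))
          (XBig κ ρ₂ 𝔭bar (∅ : Set (HeightOneSpectrum (𝓞 K))))),
        Module.Finite (PowerSeries (PowerSeries ℤ_[p])) (XBig κ ρ₂ 𝔭bar (∅ : Set (HeightOneSpectrum (𝓞 K)))) ∧
        (∃ s : PowerSeries (PowerSeries ℤ_[p]),
          ¬ (PowerSeries.C (PowerSeries.X : PowerSeries ℤ_[p]) ∣ s) ∧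
            ∀ m : XBig κ ρ₂ 𝔭bar (∅ : Set (HeightOneSpectrum (𝓞 K))), s • m = 0) ∧
        (∃ j : ℕ, Ideal.span {PowerSeries.C ((p : ℤ_[p]) ^ j)} *
            (Literature.NumberTheory.EllipticCurves.Module.charIdeal (PowerSeries (PowerSeries ℤ_[p]))
                (XBig κ ρ₂ 𝔭bar (∅ : Set (HeightOneSpectrum (𝓞 K))))).map
              (PowerSeries.map (PowerSeries.constantCoeff (R := ℤ_[p]))) ≤
          XAc.charIdeal (W.baseChange K) p κ 𝔭bar ∅ γ) ∧
        ∃ bad : Set ℤ_[p], bad.Finite ∧ ∀ k : ℕ, x k ∉ bad →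
          (∃ s : PowerSeries (PowerSeries ℤ_[p]),
            ¬ (PowerSeries.C (PowerSeries.X - PowerSeries.C (x k)) ∣ s) ∧
              ∀ m : XBig κ ρ₂ 𝔭bar (∅ : Set (HeightOneSpectrum (𝓞 K))), s • m = 0) ∧
          ∀ (b : padicCoeffIntegers (D k).ι →+* 𝓞_ℂ_[p]),
            (∀ y, ((b y : 𝓞_ℂ_[p]) : ℂ_[p]) =
              algebraMap (PadicAlgCl p) ℂ_[p] (padicCoeffIntegers.toPadicAlgCl (D k).ι y)) →
          ∀ [TopologicalSpace (PowerSeries (padicCoeffIntegers (D k).ι))]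
            [ContinuousSMul (PowerSeries (padicCoeffIntegers (D k).ι))
              (BigRepModule (padicCoeffIntegers (D k).ι) p (Cofree (D k).Δ.selfDualRep (padicCoeffField (D k).ι)))],
            ∃ j : ℕ, Ideal.span {PowerSeries.C ((p : 𝓞_ℂ_[p]) ^ j)} *
                (XBig.charIdeal κ ((D k).Δ.selfDualCofreeRepOver K) 𝔭bar
                  (∅ : Set (HeightOneSpectrum (𝓞 K)))).map (PowerSeries.map b) ≤
              (Literature.NumberTheory.EllipticCurves.Module.charIdeal (PowerSeries ℤ_[p])
                  (QuotSMulTop (PowerSeries.C (PowerSeries.X - PowerSeries.C (x k)))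
                    (XBig κ ρ₂ 𝔭bar (∅ : Set (HeightOneSpectrum (𝓞 K)))))).map
                (PowerSeries.map (R1.toCpInt p))
    ) :
    ∀ (W : WeierstrassCurve ℚ) [W.IsElliptic] [W.IsGloballyMinimal] (p : ℕ) [Fact p.Prime],
    ∀ (N : ℕ) [NeZero N] (K : Type) [Field K] [NumberField K] (Dt : ModularParametrizationData W N)
      (H : HeegnerDatum N (NumberField.discr K)) (ιK : K →+* ℂ) (P : (W.baseChange K).toAffine.Point),
      CellC W p → W.conductorNorm ℤ = N →
      IsImaginaryQuadratic K → NumberField.discr K < -4 → SatisfiesHeegnerHypothesis N K →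
      (W.quadraticTwist (NumberField.discr K : ℚ)).entireLFunction 1 ≠ 0 →
      WeierstrassCurve.Affine.Point.map ιK.toRatAlgHom P = heegnerPointComplex Dt H →
      ¬ (p : ℤ) ∣ Dt.c → ¬ IsOfFinAddOrder P →
      Odd (NumberField.discr K) →
      ∀ (κ : ZpExtension K p), κ.IsAnticyclotomic →
        ∀ (γ : Field.absoluteGaloisGroup K) [Fact (κ.IsTopGenerator γ)]
          (𝔭 : HeightOneSpectrum (𝓞 K)), ((p : ℕ) : 𝓞 K) ∈ 𝔭.asIdeal →
          𝔭.asIdeal.ramificationIdx (𝓞 ℚ) = 1 → 𝔭.asIdeal.inertiaDeg (𝓞 ℚ) = 1 →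
          ∀ (𝔭bar : HeightOneSpectrum (𝓞 K)), ((p : ℕ) : 𝓞 K) ∈ 𝔭bar.asIdeal → 𝔭bar ≠ 𝔭 →
            ((Ideal.span {(p : ℤ)}).primesOver (𝓞 K)).ncard = 2 →
          ∀ (f : CuspForm (CongruenceSubgroup.Gamma0 N) 2), IsNewformOf W f →
            ∀ (ι' : PadicAlgCl p ≃+* ℂ),
              (∀ (w : InfinitePlace K) (k : 𝓞 K),
                k ∈ 𝔭.asIdeal ↔ ‖ι'.symm (w.embedding (k : K))‖ < 1) →
              ∀ (ΩK : ℂ) (Ωp : ℂ_[p]) (Q : PowerSeries 𝓞_ℂ_[p]), ΩK ≠ 0 → ‖Ωp‖ = 1 →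
                R1.IsBDPLFunctionInt p ι' 𝔭 κ γ f ΩK Ωp Q →
      ∀ (L : PowerSeries (PowerSeries (unrIntegers p))) (x : ℕ → ℤ_[p]) (D : ℕ → Skinner2016.HidaCongruentForm W p 1),
        (∀ k, ‖x k‖ < 1) ∧ Filter.Tendsto x Filter.atTop (nhds 0) ∧
        (∃ e : ℕ, PowerSeries.C ((p : 𝓞_ℂ_[p]) ^ e) * Q ∈
          Ideal.span {PowerSeries.map (R1.unrToCpInt p) (PowerSeries.map (PowerSeries.constantCoeff (R := unrIntegers p)) L)}) ∧
        (∀ k : ℕ, (∀ y : coeffField (D k).g, ι' ((D k).ι y) = (y : ℂ)) ∧ 2 * ((p : ℤ) - 1) ∣ (D k).k - 2 ∧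
          ∃ (ΩKg : ℂ) (Ωpg : ℂ_[p]) (Lg : UnrSeries p), ΩKg ≠ 0 ∧ ‖Ωpg‖ = 1 ∧
            IsBDPLFunctionWt ι' 𝔭 κ γ (D k).g ΩKg Ωpg Lg ∧
          ∃ Ψ : UnrSeries p,
            (∃ U : PowerSeries (PowerSeries (unrIntegers p)),
              PowerSeries.map (PowerSeries.C (R := unrIntegers p)) Ψ =
                L + PowerSeries.C (PowerSeries.X - PowerSeries.C (toUnr p (x k))) * U) ∧
            (∃ e : ℕ, PowerSeries.C ((p : 𝓞_ℂ_[p]) ^ e) * PowerSeries.map (R1.unrToCpInt p) Ψ ∈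
              Ideal.span {PowerSeries.map (R1.unrToCpInt p) Lg})) ∧
        (∃ A : ℕ → UnrSeries p, ∀ ℓ : ℕ, ℓ.Prime → ¬ ℓ ∣ N →
          (∃ U : UnrSeries p, A ℓ = PowerSeries.C (toUnr p ((W.frobeniusTrace ℓ : ℤ) : ℤ_[p])) + PowerSeries.X * U) ∧
          ∀ k : ℕ, ∃ (c : unrIntegers p) (U : UnrSeries p),
            A ℓ = PowerSeries.C c + (PowerSeries.X - PowerSeries.C (toUnr p (x k))) * U ∧
            ((c : ℂ_[p]) = algebraMap (PadicAlgCl p) ℂ_[p]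
              ((D k).ι ⟨(UpperHalfPlane.qExpansion 1 ⇑(D k).g).coeff ℓ, coeff_mem_coeffField (D k).g ℓ⟩))) ∧
        (∃ M : ℕ, ∀ k : ℕ, ((p : ℤ_[p]) ^ M) * x k = (((D k).k - 2 : ℤ) : ℤ_[p])) ∧
        (∀ k : ℕ, Function.Surjective (algebraMap ℤ_[p] (padicCoeffIntegers (D k).ι))) →
      ∃ F₀ : PowerSeries (PowerSeries ℤ_[p]),
        ¬ (PowerSeries.C (PowerSeries.X : PowerSeries ℤ_[p]) ∣ F₀) ∧
        (∃ j : ℕ, PowerSeries.C ((p : 𝓞_ℂ_[p]) ^ j) *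
            PowerSeries.map (R1.toCpInt p) (PowerSeries.map (PowerSeries.constantCoeff (R := ℤ_[p])) F₀) ∈
          (XAc.charIdeal (W.baseChange K) p κ 𝔭bar ∅ γ).map (PowerSeries.map (R1.toCpInt p))) ∧
        ∃ bad : Set ℤ_[p], bad.Finite ∧ ∀ k : ℕ, x k ∉ bad → ∃ Φ₀ : PowerSeries ℤ_[p], Φ₀ ≠ 0 ∧
          (∃ U : PowerSeries (PowerSeries ℤ_[p]),
            PowerSeries.map (PowerSeries.C (R := ℤ_[p])) Φ₀ =
              F₀ + PowerSeries.C (PowerSeries.X - PowerSeries.C (x k)) * U) ∧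
          ∀ (b : padicCoeffIntegers (D k).ι →+* 𝓞_ℂ_[p]),
            (∀ y, ((b y : 𝓞_ℂ_[p]) : ℂ_[p]) =
              algebraMap (PadicAlgCl p) ℂ_[p] (padicCoeffIntegers.toPadicAlgCl (D k).ι y)) →
          ∀ [TopologicalSpace (PowerSeries (padicCoeffIntegers (D k).ι))]
            [ContinuousSMul (PowerSeries (padicCoeffIntegers (D k).ι))
              (BigRepModule (padicCoeffIntegers (D k).ι) p (Cofree (D k).Δ.selfDualRep (padicCoeffField (D k).ι)))],
            ∃ j : ℕ, Ideal.span {PowerSeries.C ((p : 𝓞_ℂ_[p]) ^ j)} *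
                (XBig.charIdeal κ ((D k).Δ.selfDualCofreeRepOver K) 𝔭bar
                  (∅ : Set (HeightOneSpectrum (𝓞 K)))).map (PowerSeries.map b) ≤
              Ideal.span {PowerSeries.map (R1.toCpInt p) Φ₀}
 := by
  intro W _ _ p _ N _ K _ _ Dt H ιK P hC hN hK hdisc hHeeg hL1 hP hc hfin hodd κ hκ γ _ 𝔭 h𝔭 hram hdeg 𝔭bar
    h𝔭bar hne hsp f hf ι' hι' ΩK Ωp Q hΩK hΩp hQ L x D hpkg
  obtain ⟨τ₁, A₂, _iA1, _iA2, _iA3, _iA4, ρ₂, τ₂, _iC, _iM, _iT, hfg, ⟨s₀, hs₀π, hs₀⟩, ⟨j₀, hj₀⟩, Fx, hFx, hmem⟩ :=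
    hM W p N K Dt H ιK P hC hN hK hdisc hHeeg hL1 hP hc hfin hodd κ hκ γ 𝔭 h𝔭 hram hdeg 𝔭bar h𝔭bar hne
      hsp f hf ι' hι' ΩK Ωp Q hΩK hΩp hQ L x D hpkg
  have hxk : ∀ k, ‖x k‖ < 1 := hpkg.1
  haveI hufdB : UniqueFactorizationMonoid (PowerSeries (PowerSeries ℤ_[p])) :=
    Literature.NumberTheory.IwasawaTheory.uniqueFactorizationMonoid_powerSeries_powerSeries ℤ_[p]
  haveI : Module.Finite (PowerSeries (PowerSeries ℤ_[p]))
      (XBig κ ρ₂ 𝔭bar (∅ : Set (HeightOneSpectrum (𝓞 K)))) := hfg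
  -- the retraction `φ₀ = (X ↦ 0)`, kernel `(C X)`
  have hφ₀π : (PowerSeries.map (PowerSeries.constantCoeff (R := ℤ_[p])))
      (PowerSeries.C (PowerSeries.X : PowerSeries ℤ_[p])) = 0 := by
    rw [PowerSeries.map_C, PowerSeries.constantCoeff_X, map_zero]
  have hφ₀ker : ∀ b : PowerSeries (PowerSeries ℤ_[p]),
      (PowerSeries.map (PowerSeries.constantCoeff (R := ℤ_[p]))) b = 0 →
        PowerSeries.C (PowerSeries.X : PowerSeries ℤ_[p]) ∣ b :=
    fun b hb => TelescopeK2DivIntOfModuleDiv.C_X_dvd_of_map_constantCoeff_eq_zero b hb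
  have hπ₀0 : (PowerSeries.C (PowerSeries.X : PowerSeries ℤ_[p]) : PowerSeries (PowerSeries ℤ_[p])) ≠ 0 := by
    intro h
    have h1 := congrArg (PowerSeries.constantCoeff (R := PowerSeries ℤ_[p])) h
    rw [PowerSeries.constantCoeff_C, map_zero] at h1
    exact PowerSeries.X_ne_zero h1
  -- `F₀` := a generator of `char_B(X₂)` with `F₀(0,T) ≠ 0`
  obtain ⟨F₀, hF₀, hφF₀⟩ := RetractionSpecialization.exists_charIdeal_eq_span_of_retraction (A := PowerSeries ℤ_[p])
    (N := XBig κ ρ₂ 𝔭bar (∅ : Set (HeightOneSpectrum (𝓞 K)))) hφ₀π hφ₀ker hπ₀0 (s := s₀)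
    (fun h => hs₀π (hφ₀ker _ h)) hs₀
  -- (nondeg)
  have hX₀ : ¬ (PowerSeries.C (PowerSeries.X : PowerSeries ℤ_[p]) ∣ F₀) := by
    rintro ⟨G, hG⟩
    apply hφF₀
    rw [hG, map_mul, hφ₀π, zero_mul]
  -- (alg∞): read off (div₀), pushed to `𝓞_{ℂ_p}⟦T⟧`
  have halg : ∃ j : ℕ, PowerSeries.C ((p : 𝓞_ℂ_[p]) ^ j) *
      PowerSeries.map (R1.toCpInt p) (PowerSeries.map (PowerSeries.constantCoeff (R := ℤ_[p])) F₀) ∈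
        (XAc.charIdeal (W.baseChange K) p κ 𝔭bar ∅ γ).map (PowerSeries.map (R1.toCpInt p)) := by
    refine ⟨j₀, ?_⟩
    have h1 : PowerSeries.map (PowerSeries.constantCoeff (R := ℤ_[p])) F₀ ∈
        (Literature.NumberTheory.EllipticCurves.Module.charIdeal (PowerSeries (PowerSeries ℤ_[p]))
            (XBig κ ρ₂ 𝔭bar (∅ : Set (HeightOneSpectrum (𝓞 K))))).map
          (PowerSeries.map (PowerSeries.constantCoeff (R := ℤ_[p]))) := by
      rw [hF₀, Ideal.map_span, Set.image_singleton]
      exact Ideal.mem_span_singleton_self _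
    have h2 : PowerSeries.C ((p : ℤ_[p]) ^ j₀) *
        PowerSeries.map (PowerSeries.constantCoeff (R := ℤ_[p])) F₀ ∈
        XAc.charIdeal (W.baseChange K) p κ 𝔭bar ∅ γ :=
      hj₀ (Ideal.mul_mem_mul (Ideal.mem_span_singleton_self _) h1)
    have h3 := Ideal.mem_map_of_mem (PowerSeries.map (R1.toCpInt p)) h2
    rw [map_mul, PowerSeries.map_C, map_pow, map_natCast] at h3
    exact h3
  refine ⟨F₀, hX₀, halg, Fx, hFx, fun k hk => ?_⟩
  -- member `k`: the evaluation retraction `φ_k = (X ↦ x_k)` (LEAD's landed §E, `𝒪 = ℤ_p`)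
  obtain ⟨⟨s, hsπ, hs⟩, hctrl⟩ := hmem k hk
  have ha : x k ∈ IsLocalRing.maximalIdeal ℤ_[p] := by
    rw [PadicInt.maximalIdeal_eq_span_p, Ideal.mem_span_singleton]
    exact (PadicInt.norm_lt_one_iff_dvd (x k)).mp (hxk k)
  let φ : PowerSeries (PowerSeries ℤ_[p]) →+* PowerSeries ℤ_[p] :=
    PowerSeries.map (AccumHelpers.evAt (x k) ha).toRingHom
  have hφC : ∀ g : PowerSeries ℤ_[p],
      φ (algebraMap (PowerSeries ℤ_[p]) (PowerSeries (PowerSeries ℤ_[p])) g) = g :=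
    fun g => TelescopeCarrierAlgOfWitness.evAtMap_map_C _ ha g
  have hφC' : ∀ g : PowerSeries ℤ_[p], φ (PowerSeries.map (PowerSeries.C (R := ℤ_[p])) g) = g :=
    fun g => TelescopeCarrierAlgOfWitness.evAtMap_map_C _ ha g
  have hφπ : φ (PowerSeries.C (PowerSeries.X - PowerSeries.C (x k))) = 0 :=
    TelescopeCarrierAlgOfWitness.evAtMap_pi _ ha
  have hφker : ∀ b : PowerSeries (PowerSeries ℤ_[p]), φ b = 0 →
      PowerSeries.C (PowerSeries.X - PowerSeries.C (x k)) ∣ b :=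
    fun b hb => TelescopeCarrierAlgOfWitness.C_dvd_of_evAtMap_eq_zero _ ha b hb
  have hπ0 : (PowerSeries.C (PowerSeries.X - PowerSeries.C (x k)) : PowerSeries (PowerSeries ℤ_[p])) ≠ 0 := by
    intro h
    have h1 := congrArg (PowerSeries.constantCoeff (R := PowerSeries ℤ_[p])) h
    rw [PowerSeries.constantCoeff_C, map_zero, sub_eq_zero] at h1
    have h2 := congrArg (PowerSeries.coeff 1) h1
    rw [PowerSeries.coeff_one_X, PowerSeries.coeff_C, if_neg one_ne_zero] at h2
    exact one_ne_zero h2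
  -- `Φ₀ := F₀(x_k,T) ≠ 0`
  obtain ⟨Fk, hFk, hφFk⟩ := RetractionSpecialization.exists_charIdeal_eq_span_of_retraction (A := PowerSeries ℤ_[p])
    (N := XBig κ ρ₂ 𝔭bar (∅ : Set (HeightOneSpectrum (𝓞 K)))) hφπ hφker hπ0 (s := s)
    (fun h => hsπ (hφker _ h)) hs
  have hΦ0 : φ F₀ ≠ 0 := by
    intro h0
    apply hφFk
    have hass : Associated F₀ Fk := by
      rw [← Ideal.span_singleton_eq_span_singleton, ← hF₀, ← hFk]
    obtain ⟨u, hu⟩ := hass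
    rw [← hu, map_mul, h0, zero_mul]
  refine ⟨φ F₀, hΦ0, ?_, ?_⟩
  · -- remainder form
    have hdvd : PowerSeries.C (PowerSeries.X - PowerSeries.C (x k)) ∣
        PowerSeries.map (PowerSeries.C (R := ℤ_[p])) (φ F₀) - F₀ := by
      refine hφker _ ?_
      rw [map_sub, hφC', sub_self]
    obtain ⟨U, hU⟩ := hdvd
    exact ⟨U, by rw [← hU, add_sub_cancel]⟩
  · -- one-sided Herbrand at `X ↦ x_k` under (ctrl_k), read in `𝓞_{ℂ_p}⟦T⟧`
    intro b hb _ _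
    obtain ⟨j, hj⟩ := hctrl b hb
    refine ⟨j, hj.trans ?_⟩
    have hle := TelescopeHerbrandTranslate.stub_herbrandTranslate (PowerSeries ℤ_[p]) (PowerSeries (PowerSeries ℤ_[p])) inferInstance hufdB _ φ hφC hφπ hφker
      (XBig κ ρ₂ 𝔭bar (∅ : Set (HeightOneSpectrum (𝓞 K)))) ⟨s, hsπ, hs⟩
    refine (Ideal.map_mono hle).trans ?_
    rw [hF₀, Ideal.map_span, Set.image_singleton, Ideal.map_span, Set.image_singleton]

end Summit.BirchSwinnertonDyer.BirchSwinnertonDyer.Theorems.TelescopeK2DivIntOfModuleDivFP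

end
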